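import Mathlib
import HarnessLib
import Summits.FinalStateConjecture.Statement
import Literature.Geometry.Lorentzian.LandauLifshitzPseudotensor

/-!
# Route EIHFluxBalance — `InertialRecession`, re-charting: chain rules through a scalar map

Helper file for the crux `stmt-FinalStateConjecture-10166`
(`Summit.FinalStateConjecture.FinalStateConjecture.Theses.EIHFluxBalance.InertialRecession`),
line `sublinear-is-free-clean-window-charges`, stub `stub_rechart` (the transfer P2), part G1.

The honest hole chart of the transfer is `ψ(y) = c(T(y)) + M(T(y)) ỹ` with a scalar "lab clock"
`T : E4 → ℝ` and one-variable data `c, M` (painted centre, purged frame). Its `C³`-closeness to a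
Poincaré map is read off NORM CHAIN RULES for compositions `a ∘ T` of a vector-valued one-variable
function `a : ℝ → G` with a scalar function `T : E → ℝ`, to third order, which this file provides
in a general normed-space setting:

* `fderiv_comp_scalar` — `D(a ∘ T)(y) = DT(y) ⊗ a'(T y)`;
* `norm_iteratedFDeriv_one_comp_scalar_le`, `…_two_…`, `…_three_…` —
  `‖D(a∘T)‖ ≤ ‖a'‖‖DT‖`, `‖D²(a∘T)‖ ≤ ‖a''‖‖DT‖² + ‖a'‖‖D²T‖`,
  `‖D³(a∘T)‖ ≤ ‖a'''‖‖DT‖³ + 3‖a''‖‖DT‖‖D²T‖ + ‖a'‖‖D³T‖` (all data at the point `y`, resp. `T y`);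
* `tendsto_iteratedDeriv_bilinear_of_one_le` — Leibniz decay for `t ↦ B (f t) (g t)` when `f, g`
  are eventually bounded and their derivatives of orders `1, …, n` tend to `0`.

[folklore: Faà di Bruno to third order]
-/

noncomputable section

set_option linter.dupNamespace false

open Set Filter Function Topology
open scoped ContDiff

namespace Summit.FinalStateConjecture.FinalStateConjecture.Theorems.SublinearIsFree.Rechart

section Chain

variable {E G : Type*} [NormedAddCommGroup E] [NormedSpace ℝ E] [NormedAddCommGroup G]
  [NormedSpace ℝ G]

/-- **First-order chain rule through a scalar map**: `D(a ∘ T)(y) = DT(y) ⊗ a'(T y)`. [folklore] -/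
theorem hasFDerivAt_comp_scalar {a : ℝ → G} {T : E → ℝ} {y : E} {a' : G} {T' : E →L[ℝ] ℝ}
    (ha : HasDerivAt a a' (T y)) (hT : HasFDerivAt T T' y) :
    HasFDerivAt (fun y ↦ a (T y)) (T'.smulRight a') y := by
  have h := ha.hasFDerivAt.comp y hT
  have heq : T'.smulRight a' = (ContinuousLinearMap.toSpanSingleton ℝ a').comp T' := by
    ext v
    simp [ContinuousLinearMap.toSpanSingleton_apply]
  rw [heq]
  exact h

/-- The derivative of `a ∘ T` as a function: `y ↦ DT(y) ⊗ a'(T y)`. [folklore] -/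
theorem fderiv_comp_scalar {a : ℝ → G} {T : E → ℝ} (ha : Differentiable ℝ a)
    (hT : Differentiable ℝ T) :
    fderiv ℝ (fun y ↦ a (T y)) = fun y ↦ (fderiv ℝ T y).smulRight (deriv a (T y)) :=
  funext fun y ↦ (hasFDerivAt_comp_scalar (ha (T y)).hasDerivAt (hT y).hasFDerivAt).fderiv

/-- The derivative of `a ∘ T` written with the bilinear map `smulRightL`. [folklore] -/
theorem fderiv_comp_scalar_eq_smulRightL {a : ℝ → G} {T : E → ℝ} (ha : Differentiable ℝ a)
    (hT : Differentiable ℝ T) :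
    fderiv ℝ (fun y ↦ a (T y)) =
      fun y ↦ ContinuousLinearMap.smulRightL ℝ E G (fderiv ℝ T y) (deriv a (T y)) := by
  rw [fderiv_comp_scalar ha hT]
  rfl

/-- **Norm chain rule, order one**: `‖D(a ∘ T)(y)‖ ≤ ‖a'(T y)‖ ‖DT(y)‖`. [folklore] -/
theorem norm_iteratedFDeriv_one_comp_scalar_le {a : ℝ → G} {T : E → ℝ} (ha : Differentiable ℝ a)
    (hT : Differentiable ℝ T) (y : E) {A₁ D₁ : ℝ} (hA₁ : ‖deriv a (T y)‖ ≤ A₁)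
    (hD₁ : ‖iteratedFDeriv ℝ 1 T y‖ ≤ D₁) :
    ‖iteratedFDeriv ℝ 1 (fun y ↦ a (T y)) y‖ ≤ A₁ * D₁ := by
  have hD0 : 0 ≤ D₁ := (norm_nonneg _).trans hD₁
  rw [← norm_iteratedFDeriv_fderiv, norm_iteratedFDeriv_zero, fderiv_comp_scalar ha hT,
    ContinuousLinearMap.norm_smulRight_apply]
  rw [← norm_iteratedFDeriv_fderiv, norm_iteratedFDeriv_zero] at hD₁
  rw [mul_comm]
  exact mul_le_mul hA₁ hD₁ (norm_nonneg _) ((norm_nonneg _).trans hA₁)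

/-- **Norm chain rule, order two**: `‖D²(a ∘ T)(y)‖ ≤ ‖a''(T y)‖ ‖DT(y)‖² + ‖a'(T y)‖ ‖D²T(y)‖`.
[folklore] -/
theorem norm_iteratedFDeriv_two_comp_scalar_le {a : ℝ → G} {T : E → ℝ} (ha : ContDiff ℝ 2 a)
    (hT : ContDiff ℝ 2 T) (y : E) {A₁ A₂ D₁ D₂ : ℝ} (hA₁ : ‖deriv a (T y)‖ ≤ A₁)
    (hA₂ : ‖iteratedDeriv 2 a (T y)‖ ≤ A₂) (hD₁ : ‖iteratedFDeriv ℝ 1 T y‖ ≤ D₁)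
    (hD₂ : ‖iteratedFDeriv ℝ 2 T y‖ ≤ D₂) :
    ‖iteratedFDeriv ℝ 2 (fun y ↦ a (T y)) y‖ ≤ A₂ * D₁ ^ 2 + A₁ * D₂ := by
  have hD0 : 0 ≤ D₁ := (norm_nonneg _).trans hD₁
  have hD20 : 0 ≤ D₂ := (norm_nonneg _).trans hD₂
  have hA0 : 0 ≤ A₁ := (norm_nonneg _).trans hA₁
  have had : Differentiable ℝ a := ha.differentiable (by norm_num)
  have hTd : Differentiable ℝ T := hT.differentiable (by norm_num)
  have ha' : ContDiff ℝ 1 (deriv a) := by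
    have := ha.iterate_deriv' 1 1
    simpa using this
  have ha'd : Differentiable ℝ (deriv a) := ha'.differentiable (by simp)
  -- `D²(a∘T) = D¹(y ↦ B (DT y) (a'(T y)))`
  rw [← norm_iteratedFDeriv_fderiv, fderiv_comp_scalar_eq_smulRightL had hTd]
  have hf : ContDiff ℝ 1 (fun y ↦ fderiv ℝ T y) := hT.fderiv_right le_rfl
  have hg : ContDiff ℝ 1 (fun y ↦ deriv a (T y)) := ha'.comp (hT.of_le (by norm_num))
  letI : NormedAddCommGroup (G →L[ℝ] (E →L[ℝ] G)) := ContinuousLinearMap.toNormedAddCommGroup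
  letI : NormedSpace ℝ (G →L[ℝ] (E →L[ℝ] G)) := ContinuousLinearMap.toNormedSpace
  have hB : ‖ContinuousLinearMap.smulRightL ℝ E G‖ ≤ 1 := ContinuousLinearMap.norm_smulRightL_le
  have h := (ContinuousLinearMap.smulRightL ℝ E G).norm_iteratedFDeriv_le_of_bilinear_of_le_one
    hf hg y (n := 1) le_rfl hB
  refine h.trans ?_
  have hsum : ∑ i ∈ Finset.range (1 + 1), ((1 : ℕ).choose i : ℝ) *
      ‖iteratedFDeriv ℝ i (fun y ↦ fderiv ℝ T y) y‖ *
        ‖iteratedFDeriv ℝ (1 - i) (fun y ↦ deriv a (T y)) y‖ =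
      ‖fderiv ℝ T y‖ * ‖iteratedFDeriv ℝ 1 (fun y ↦ deriv a (T y)) y‖ +
        ‖iteratedFDeriv ℝ 1 (fun y ↦ fderiv ℝ T y) y‖ * ‖deriv a (T y)‖ := by
    simp [Finset.sum_range_succ]
  rw [hsum]
  -- the two terms
  have h1 : ‖iteratedFDeriv ℝ 1 (fun y ↦ deriv a (T y)) y‖ ≤ A₂ * D₁ := by
    refine norm_iteratedFDeriv_one_comp_scalar_le ha'd hTd y ?_ hD₁
    rw [show (2 : ℕ) = 1 + 1 from rfl, iteratedDeriv_succ, iteratedDeriv_one] at hA₂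
    exact hA₂
  have h2 : ‖iteratedFDeriv ℝ 1 (fun y ↦ fderiv ℝ T y) y‖ ≤ D₂ := by
    rw [norm_iteratedFDeriv_fderiv]; exact hD₂
  have h3 : ‖fderiv ℝ T y‖ ≤ D₁ := by
    rw [← norm_iteratedFDeriv_fderiv, norm_iteratedFDeriv_zero] at hD₁; exact hD₁
  calc ‖fderiv ℝ T y‖ * ‖iteratedFDeriv ℝ 1 (fun y ↦ deriv a (T y)) y‖ +
        ‖iteratedFDeriv ℝ 1 (fun y ↦ fderiv ℝ T y) y‖ * ‖deriv a (T y)‖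
      ≤ D₁ * (A₂ * D₁) + D₂ * A₁ := by
        gcongr
    _ = A₂ * D₁ ^ 2 + A₁ * D₂ := by ring

/-- **Norm chain rule, order three**:
`‖D³(a ∘ T)(y)‖ ≤ ‖a'''‖ ‖DT‖³ + 3 ‖a''‖ ‖DT‖ ‖D²T‖ + ‖a'‖ ‖D³T‖` (all at `y`, resp. `T y`).
[folklore] -/
theorem norm_iteratedFDeriv_three_comp_scalar_le {a : ℝ → G} {T : E → ℝ} (ha : ContDiff ℝ 3 a)
    (hT : ContDiff ℝ 3 T) (y : E) {A₁ A₂ A₃ D₁ D₂ D₃ : ℝ} (hA₁ : ‖deriv a (T y)‖ ≤ A₁)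
    (hA₂ : ‖iteratedDeriv 2 a (T y)‖ ≤ A₂) (hA₃ : ‖iteratedDeriv 3 a (T y)‖ ≤ A₃)
    (hD₁ : ‖iteratedFDeriv ℝ 1 T y‖ ≤ D₁) (hD₂ : ‖iteratedFDeriv ℝ 2 T y‖ ≤ D₂)
    (hD₃ : ‖iteratedFDeriv ℝ 3 T y‖ ≤ D₃) :
    ‖iteratedFDeriv ℝ 3 (fun y ↦ a (T y)) y‖ ≤
      A₃ * D₁ ^ 3 + 3 * A₂ * D₁ * D₂ + A₁ * D₃ := by
  have hD0 : 0 ≤ D₁ := (norm_nonneg _).trans hD₁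
  have hD20 : 0 ≤ D₂ := (norm_nonneg _).trans hD₂
  have hD30 : 0 ≤ D₃ := (norm_nonneg _).trans hD₃
  have hA0 : 0 ≤ A₁ := (norm_nonneg _).trans hA₁
  have hA20 : 0 ≤ A₂ := (norm_nonneg _).trans hA₂
  have had : Differentiable ℝ a := ha.differentiable (by norm_num)
  have hTd : Differentiable ℝ T := hT.differentiable (by norm_num)
  have ha' : ContDiff ℝ 2 (deriv a) := by
    have := ha.iterate_deriv' 2 1
    simpa using this
  rw [← norm_iteratedFDeriv_fderiv, fderiv_comp_scalar_eq_smulRightL had hTd]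
  have hf : ContDiff ℝ 2 (fun y ↦ fderiv ℝ T y) := hT.fderiv_right le_rfl
  have hg : ContDiff ℝ 2 (fun y ↦ deriv a (T y)) := ha'.comp (hT.of_le (by norm_num))
  letI : NormedAddCommGroup (G →L[ℝ] (E →L[ℝ] G)) := ContinuousLinearMap.toNormedAddCommGroup
  letI : NormedSpace ℝ (G →L[ℝ] (E →L[ℝ] G)) := ContinuousLinearMap.toNormedSpace
  have hB : ‖ContinuousLinearMap.smulRightL ℝ E G‖ ≤ 1 := ContinuousLinearMap.norm_smulRightL_le
  have h := (ContinuousLinearMap.smulRightL ℝ E G).norm_iteratedFDeriv_le_of_bilinear_of_le_one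
    hf hg y (n := 2) le_rfl hB
  refine h.trans ?_
  have hsum : ∑ i ∈ Finset.range (2 + 1), ((2 : ℕ).choose i : ℝ) *
      ‖iteratedFDeriv ℝ i (fun y ↦ fderiv ℝ T y) y‖ *
        ‖iteratedFDeriv ℝ (2 - i) (fun y ↦ deriv a (T y)) y‖ =
      ‖fderiv ℝ T y‖ * ‖iteratedFDeriv ℝ 2 (fun y ↦ deriv a (T y)) y‖ +
        2 * ‖iteratedFDeriv ℝ 1 (fun y ↦ fderiv ℝ T y) y‖ *
          ‖iteratedFDeriv ℝ 1 (fun y ↦ deriv a (T y)) y‖ +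
        ‖iteratedFDeriv ℝ 2 (fun y ↦ fderiv ℝ T y) y‖ * ‖deriv a (T y)‖ := by
    simp [Finset.sum_range_succ]
  rw [hsum]
  -- bounds on the pieces: `a'` in place of `a`
  have hA₂' : ‖deriv (deriv a) (T y)‖ ≤ A₂ := by
    rw [show (2 : ℕ) = 1 + 1 from rfl, iteratedDeriv_succ, iteratedDeriv_one] at hA₂
    exact hA₂
  have hA₃' : ‖iteratedDeriv 2 (deriv a) (T y)‖ ≤ A₃ := by
    rw [iteratedDeriv_succ'] at hA₃; exact hA₃
  have h1 : ‖iteratedFDeriv ℝ 2 (fun y ↦ deriv a (T y)) y‖ ≤ A₃ * D₁ ^ 2 + A₂ * D₂ :=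
    norm_iteratedFDeriv_two_comp_scalar_le ha' (hT.of_le (by norm_num)) y hA₂' hA₃' hD₁ hD₂
  have h2 : ‖iteratedFDeriv ℝ 1 (fun y ↦ deriv a (T y)) y‖ ≤ A₂ * D₁ :=
    norm_iteratedFDeriv_one_comp_scalar_le (ha'.differentiable (by norm_num)) hTd y hA₂' hD₁
  have h3 : ‖iteratedFDeriv ℝ 1 (fun y ↦ fderiv ℝ T y) y‖ ≤ D₂ := by
    rw [norm_iteratedFDeriv_fderiv]; exact hD₂
  have h4 : ‖iteratedFDeriv ℝ 2 (fun y ↦ fderiv ℝ T y) y‖ ≤ D₃ := by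
    rw [norm_iteratedFDeriv_fderiv]; exact hD₃
  have h5 : ‖fderiv ℝ T y‖ ≤ D₁ := by
    rw [← norm_iteratedFDeriv_fderiv, norm_iteratedFDeriv_zero] at hD₁; exact hD₁
  calc ‖fderiv ℝ T y‖ * ‖iteratedFDeriv ℝ 2 (fun y ↦ deriv a (T y)) y‖ +
        2 * ‖iteratedFDeriv ℝ 1 (fun y ↦ fderiv ℝ T y) y‖ *
          ‖iteratedFDeriv ℝ 1 (fun y ↦ deriv a (T y)) y‖ +
        ‖iteratedFDeriv ℝ 2 (fun y ↦ fderiv ℝ T y) y‖ * ‖deriv a (T y)‖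
      ≤ D₁ * (A₃ * D₁ ^ 2 + A₂ * D₂) + 2 * D₂ * (A₂ * D₁) + D₃ * A₁ := by
        gcongr
    _ = A₃ * D₁ ^ 3 + 3 * A₂ * D₁ * D₂ + A₁ * D₃ := by ring

end Chain

/-! ### Leibniz decay with both factors merely bounded -/

section Leibniz

variable {E F G : Type*} [NormedAddCommGroup E] [NormedSpace ℝ E] [NormedAddCommGroup F]
  [NormedSpace ℝ F] [NormedAddCommGroup G] [NormedSpace ℝ G]

/-- **Leibniz decay, product of two slowly varying factors.** If `f` and `g` are smooth, eventually
bounded, and their derivatives of orders `1, …, n` tend to `0` at `+∞`, then for `1 ≤ m ≤ n` the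
`m`-th derivative of `t ↦ B (f t) (g t)` tends to `0` (every Leibniz term carries a derivative of
positive order on one factor). [folklore] -/
theorem tendsto_iteratedDeriv_bilinear_of_one_le (B : E →L[ℝ] F →L[ℝ] G) {f : ℝ → E} {g : ℝ → F}
    (hf : ContDiff ℝ ∞ f) (hg : ContDiff ℝ ∞ g) (n : ℕ)
    (hfb : ∃ K : ℝ, ∀ᶠ t in atTop, ‖f t‖ ≤ K) (hgb : ∃ K : ℝ, ∀ᶠ t in atTop, ‖g t‖ ≤ K)
    (hf0 : ∀ i, 1 ≤ i → i ≤ n → Tendsto (fun t ↦ iteratedDeriv i f t) atTop (𝓝 0))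
    (hg0 : ∀ i, 1 ≤ i → i ≤ n → Tendsto (fun t ↦ iteratedDeriv i g t) atTop (𝓝 0)) :
    ∀ m, 1 ≤ m → m ≤ n → Tendsto (fun t ↦ iteratedDeriv m (fun s ↦ B (f s) (g s)) t) atTop (𝓝 0) := by
  intro m hm1 hmn
  rw [tendsto_zero_iff_norm_tendsto_zero]
  -- the Leibniz bound
  have hle : ∀ t, ‖iteratedDeriv m (fun s ↦ B (f s) (g s)) t‖ ≤
      ‖B‖ * ∑ i ∈ Finset.range (m + 1), (m.choose i : ℝ) * ‖iteratedDeriv i f t‖ *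
        ‖iteratedDeriv (m - i) g t‖ := by
    intro t
    have h := B.norm_iteratedFDeriv_le_of_bilinear hf hg t (n := m) (by exact_mod_cast le_top)
    simpa only [norm_iteratedFDeriv_eq_norm_iteratedDeriv] using h
  refine squeeze_zero' (Eventually.of_forall fun t ↦ norm_nonneg _) (Eventually.of_forall hle) ?_
  rw [← mul_zero ‖B‖]
  refine Tendsto.const_mul _ ?_
  rw [← Finset.sum_const_zero]
  refine tendsto_finsetSum _ fun i hi ↦ ?_
  rw [Finset.mem_range] at hi
  -- each term: one factor is a derivative of positive order
  rcases Nat.eq_zero_or_pos i with rfl | hipos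
  · -- `i = 0`: the derivative falls on `g`
    simp only [Nat.choose_zero_right, Nat.cast_one, one_mul, iteratedDeriv_zero, Nat.sub_zero]
    obtain ⟨K, hK⟩ := hfb
    have hg' := (hg0 m hm1 hmn).norm
    rw [norm_zero] at hg'
    have hK0 : ∀ᶠ t in atTop, ‖f t‖ * ‖iteratedDeriv m g t‖ ≤ max K 0 * ‖iteratedDeriv m g t‖ :=
      hK.mono fun t ht ↦ mul_le_mul_of_nonneg_right (ht.trans (le_max_left _ _)) (norm_nonneg _)
    refine squeeze_zero' (Eventually.of_forall fun t ↦ by positivity) hK0 ?_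
    simpa using hg'.const_mul (max K 0)
  · by_cases him : i = m
    · -- `i = m`: the derivative falls on `f`
      subst him
      simp only [Nat.choose_self, Nat.cast_one, one_mul, Nat.sub_self, iteratedDeriv_zero]
      obtain ⟨K, hK⟩ := hgb
      have hf' := (hf0 i hm1 hmn).norm
      rw [norm_zero] at hf'
      have hK0 : ∀ᶠ t in atTop, ‖iteratedDeriv i f t‖ * ‖g t‖ ≤ ‖iteratedDeriv i f t‖ * max K 0 :=
        hK.mono fun t ht ↦ mul_le_mul_of_nonneg_left (ht.trans (le_max_left _ _)) (norm_nonneg _)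
      refine squeeze_zero' (Eventually.of_forall fun t ↦ by positivity) hK0 ?_
      simpa using hf'.mul_const (max K 0)
    · -- `0 < i < m`: both factors are derivatives of positive order
      have him' : i < m := lt_of_le_of_ne (Nat.lt_succ_iff.mp hi) him
      have hf' := hf0 i hipos (him'.le.trans hmn)
      have hg' := hg0 (m - i) (by omega) (le_trans (Nat.sub_le m i) hmn)
      have := (hf'.norm.mul hg'.norm).const_mul (m.choose i : ℝ)
      simpa [mul_assoc] using this

end Leibniz

/-- Registered one-line form (worker carrier `rechart_norm_iteratedFDeriv_two_comp_scalar_le`) of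
`norm_iteratedFDeriv_two_comp_scalar_le`. [folklore] -/
theorem rechart_norm_iteratedFDeriv_two_comp_scalar_le : ∀ {E G : Type*} [NormedAddCommGroup E] [NormedSpace ℝ E] [NormedAddCommGroup G] [NormedSpace ℝ G] {a : ℝ → G} {T : E → ℝ}, ContDiff ℝ 2 a → ContDiff ℝ 2 T → ∀ (y : E) {A₁ A₂ D₁ D₂ : ℝ}, ‖deriv a (T y)‖ ≤ A₁ → ‖iteratedDeriv 2 a (T y)‖ ≤ A₂ → ‖iteratedFDeriv ℝ 1 T y‖ ≤ D₁ → ‖iteratedFDeriv ℝ 2 T y‖ ≤ D₂ → ‖iteratedFDeriv ℝ 2 (fun y ↦ a (T y)) y‖ ≤ A₂ * D₁ ^ 2 + A₁ * D₂ :=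
  fun ha hT y _ _ _ _ hA₁ hA₂ hD₁ hD₂ ↦ norm_iteratedFDeriv_two_comp_scalar_le ha hT y hA₁ hA₂ hD₁ hD₂

end Summit.FinalStateConjecture.FinalStateConjecture.Theorems.SublinearIsFree.Rechart

end
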